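import Summits.QuantumFields.YangMills.Theorems.FluctuationComparisonRegPrIntLS2BetaWhitneyHatWeights
import Summits.QuantumFields.YangMills.Theorems.FluctuationComparisonRegPrIntLS2BetaGeodesicJensenLift
import HarnessLib

/-!
# S2β · `hFlat` road, brick (ii-a⁺) of UV3-NODE §57.8 — THE GEODESIC WHITNEY HAT LIFT ON THE `Setup` TORUS, ONE LEVEL:
# a SECTION of the axial average with `ℓ²`-arc cost EXACTLY `(L⁻¹)²·L^d` (= `L` in `d = 3`), inside the chart, flat on flat

Cell `ym3-torus` (rung R3 = continuum `SU(2)` Yang–Mills on the three-torus — NOT d = 4, NOT infinite volume, NOT a mass gap, NOT Clay).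
Width seat «width 12» `ym3-torus-px12` (gen 23), FREE px helper on crux `stmt-QuantumFields-20520` (`Theses.UnitScaleTilt.FluctuationComparisonRegPrIntL`),
count-neutral, DEFINITION-FREE (the lift is a plain function `V : GaugeField P t SU(2)` pinned by the displayed formula `hV` over the hat weights `hw` of
✓`…S2BetaWhitneyHatWeights`; the bundled existence statement `exists_whitneyHatLift` exposes both formulas as its first two conjuncts).

THE OBJECT (UV3-NODE §57.8 (B), px8 g21: «`I_t(U′_{t+1})` = geodesic-Whitney lift of the FINAL level-`(t+1)` field»; (D) brick list; GO 07:14:09Z with the wish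
«(W2) with `L⁻¹` and `L^d` VISIBLE»).  For a coarse field `X` on `T^{(t+1)}` the fine field on `T^{(t)}` is
    `V b := expPoint (Σ_e w b e • L⁻¹ • logVec (su2Quat (X e)))`
(geodesic convex combination, in the exponential chart at `1`, of the `L`-th roots of the `≤ 2^{d−1}` coarse bonds parallel to `b` on the edges of its coarse
cube column, with the product-hat weights).  PROVED here:
* §1 `lift_line`, `pathProd_lift`, ★★`axialAvg_lift` — (W1) **`axialAvg V = X` EXACTLY**: the lift is a SECTION of the tree's axial (centre-line) average
  (lit ✓`AveragingRT.axialAvg`); hence for the (0.4) block average `avgFun ℰ V = corr ℰ V · X` bondwise, the correction factor being a pure flap quantity.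
* §2 ★★`sum_sq_arc_lift_le` — (W2) = (R1) ON THE LATTICE: `Σ_b arc(V b)² ≤ (L⁻¹)² · L^d · Σ_e arc(X e)²` (`arc U = ‖logVec (su2Quat U)‖`), literally
  ✓(ii-a) `sum_sq_norm_logVec_lift_le` with `c = L⁻¹`, `Λ = L^d` supplied by the weights file; `sum_sq_arc_lift_le_three` — the `d = 3` reading `≤ L · Σ_e arc(X e)²`,
  i.e. `‖lift‖ ≤ √L·‖coarse‖` on the nose; `arc_lift_le` — (W3) `arc (V b) ≤ L⁻¹ · r` whenever the feeding coarse bonds have `arc ≤ r` (the lift stays in the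
  chart: after ✓p814387's iterated axial gauge every level is `s`-small, so `V` is `s∕L`-small); `lift_one` — (W4) `X = 1 ⟹ V = 1`.
* §3 ★★★`exists_whitneyHatLift` — the bundle `∃ (w, V)` with the two formulas and all of the above + the locality of `w` in `rel` currency (for (ii-b)'s
  relative comb-axial letters, px13 g22, whose background `U₀` is this `V`).

WHAT THIS FILE DOES NOT DO (located, px12 g23 07:12:49Z ∕ px8 g21 07:14:09Z (2) CONFIRMED ∕ px20 g19 CONCUR): the lift is NOT gauge-covariant, so the lift of a
FLAT non-abelian coarse field is not flat — per fine plaquette `log V(∂p) = L⁻²·(hat-weighted LINEAR curl of log X) + ½Σ[a_i, a_j] + …` with commutators of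
size `(s∕L)·(L⁻¹·arc X)`: the flap factor `F₂` of §57.8 (R2) is SIZE × ARC, not FLUX × small, and the recursion is `B_t ≤ √L·(1 + C·L·s_t)·B_{t+1} + R_t` with
`Σ_t s_t < ∞` (✓p814387) — solved depth-uniformly by ✓`…S2BetaSqrtLRecursion` v1.2 §5 (px16 g20, `recursion_varRatio_sqrtL_le`, factor `exp E`).  The fine-plaquette
∕ flap letter of the lift itself (BCH in the quaternion chart) is a separate brick, not typed here.

HONEST SCOPE.  Finite sums and the tree's quaternion exponential chart; nothing of Bałaban's analysis is asserted ([Balaban1985RegularSpaces] (1.29) p.81 is the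
printed locus of the geodesic interpolation of bond variables; [Balaban1984PropagatorsI] (1.7) p.18 of the straight contour); the recursion of §57.8, `hFlat`,
TUBE-REG∘, GAP♯∘ (`stub_uniformFibreGapOrbit`), S2β, crux 20520 and `YM3TorusSU2` are NOT proved; no registered stub is closed; the Yang–Mills mass gap is NOT proved.
References: T. Bałaban, CMP **99** (1985) 75–102 [Balaban1985RegularSpaces] ((1.29) p.81); CMP **95** (1984) 17–40 [Balaban1984PropagatorsI] ((1.7) p.18,
Prop. 1.1 (1.89)–(1.90) p.33 — the printed flat quadratic floor this road substitutes for; desk RULING №75: the token «[B6] (1.33)» has no referent).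
-/

set_option autoImplicit false

noncomputable section

namespace Summit.QuantumFields.YangMills.Theorems.FluctuationComparisonRegPrIntLS2BetaWhitneyHatLift

open Finset
open scoped Real BigOperators
open Literature.MathematicalPhysics.QuantumLattice (su2Quat)
open Literature.MathematicalPhysics.QuantumFieldTheory.Balaban1983to89
open B10Eq27TorusAxialLog (rel rel_apply)
open AveragingRT (line lineSite pathProd axialAvg)
open T4CubeChartGnomonic (SU2)
open T4HaarSU2ExpChart (expPoint expPoint_zero)
open T4HaarSU2Translate (su2Quat_one)
open T4ExpWindowSmallField (logVec norm_logVec expPoint_logVec)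
open Summit.QuantumFields.YangMills.Theorems.FluctuationComparisonRegPrIntLS2BetaWhitneyHatWeights
  (hatW_nonneg sum_hatW_eq_one sum_hatW_eq_pow hatW_line_self hatW_line_of_ne hatW_support)
open Summit.QuantumFields.YangMills.Theorems.FluctuationComparisonRegPrIntLS2BetaGeodesicJensenLift
  (sum_sq_norm_logVec_lift_le norm_logVec_lift_le_of_forall_le)
open Summit.QuantumFields.YangMills.Theorems.FluctuationComparisonRegPrIntLS2BetaDistributedHolonomySU2 (expPoint_add_smul)

variable {P : Params} {t : ℕ}

/-! ## §1 The lift is a section of the axial average -/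

/-- On the centre line of `e` the lifted bond variable is the `L`-th geodesic root of `X e`. [cite: Balaban1985RegularSpaces, (1.29) p.81] -/
theorem lift_line (ht : t + 1 ≤ P.m + P.K) (w : PBond P t → PBond P (t + 1) → ℝ)
    (hw : ∀ b e, w b e = if e.dir = b.dir ∧ (b.src b.dir - emb e.src b.dir).val < P.L then
      ∏ ν ∈ Finset.univ.erase b.dir, max 0 (1 - ((rel (emb e.src) b.src ν).natAbs : ℝ) / P.L) else 0)
    (X : GaugeField P (t + 1) SU2) (V : GaugeField P t SU2)
    (hV : ∀ b, V b = expPoint (∑ e, w b e • ((P.L : ℝ)⁻¹ • logVec (su2Quat (X e)))))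
    (e : PBond P (t + 1)) {k : ℕ} (hk : k < P.L) :
    V (line e k) = expPoint ((P.L : ℝ)⁻¹ • logVec (su2Quat (X e))) := by
  rw [hV, Finset.sum_eq_single e]
  · rw [hatW_line_self ht w hw e hk, one_smul]
  · intro e' _ he'
    rw [hatW_line_of_ne ht w hw e hk he', zero_smul]
  · exact fun h => absurd (Finset.mem_univ _) h

/-- The partial transports along the centre line are the geodesic from `1` to `X e`: `V(b₀)⋯V(b_{n−1}) = expPoint ((n∕L) • log X e)`. [folklore] -/
theorem pathProd_lift (ht : t + 1 ≤ P.m + P.K) (w : PBond P t → PBond P (t + 1) → ℝ)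
    (hw : ∀ b e, w b e = if e.dir = b.dir ∧ (b.src b.dir - emb e.src b.dir).val < P.L then
      ∏ ν ∈ Finset.univ.erase b.dir, max 0 (1 - ((rel (emb e.src) b.src ν).natAbs : ℝ) / P.L) else 0)
    (X : GaugeField P (t + 1) SU2) (V : GaugeField P t SU2)
    (hV : ∀ b, V b = expPoint (∑ e, w b e • ((P.L : ℝ)⁻¹ • logVec (su2Quat (X e)))))
    (e : PBond P (t + 1)) {n : ℕ} (hn : n ≤ P.L) :
    pathProd V e n = expPoint (((n : ℝ) * (P.L : ℝ)⁻¹) • logVec (su2Quat (X e))) := by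
  induction n with
  | zero => simp [pathProd, expPoint_zero]
  | succ n ih =>
    rw [pathProd, ih (by omega), lift_line ht w hw X V hV e (by omega)]
    rw [show ((n + 1 : ℕ) : ℝ) * (P.L : ℝ)⁻¹ = (n : ℝ) * (P.L : ℝ)⁻¹ + (P.L : ℝ)⁻¹ by push_cast; ring, expPoint_add_smul]

/-- ★★ **THE HAT LIFT IS A SECTION OF THE AXIAL AVERAGE**: `axialAvg V = X` EXACTLY (the `L` bonds of the centre line of `e` each carry
`expPoint (L⁻¹ • log X e)` and multiply to `X e`). [cite: Balaban1984PropagatorsI, (1.7) p.18] -/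
theorem axialAvg_lift (ht : t + 1 ≤ P.m + P.K) (w : PBond P t → PBond P (t + 1) → ℝ)
    (hw : ∀ b e, w b e = if e.dir = b.dir ∧ (b.src b.dir - emb e.src b.dir).val < P.L then
      ∏ ν ∈ Finset.univ.erase b.dir, max 0 (1 - ((rel (emb e.src) b.src ν).natAbs : ℝ) / P.L) else 0)
    (X : GaugeField P (t + 1) SU2) (V : GaugeField P t SU2)
    (hV : ∀ b, V b = expPoint (∑ e, w b e • ((P.L : ℝ)⁻¹ • logVec (su2Quat (X e))))) :
    axialAvg V = X := by
  funext e
  rw [axialAvg, pathProd_lift ht w hw X V hV e le_rfl, mul_inv_cancel₀ (Nat.cast_pos.mpr P.L_pos).ne', one_smul,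
    expPoint_logVec]

/-! ## §2 The `ℓ²` lift inequality (R1), the chart bound, flatness -/

/-- ★★ **(R1) ON THE LATTICE**: `Σ_b arc(V b)² ≤ (L⁻¹)² · L^d · Σ_e arc(X e)²` — ✓(ii-a) `sum_sq_norm_logVec_lift_le` instantiated with the hat weights
(partition of unity per fine bond, mass `L^d` per coarse bond, root factor `L⁻¹`). [cite: Balaban1985RegularSpaces, (1.29) p.81] -/
theorem sum_sq_arc_lift_le (ht : t + 1 ≤ P.m + P.K) (w : PBond P t → PBond P (t + 1) → ℝ)
    (hw : ∀ b e, w b e = if e.dir = b.dir ∧ (b.src b.dir - emb e.src b.dir).val < P.L then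
      ∏ ν ∈ Finset.univ.erase b.dir, max 0 (1 - ((rel (emb e.src) b.src ν).natAbs : ℝ) / P.L) else 0)
    (X : GaugeField P (t + 1) SU2) (V : GaugeField P t SU2)
    (hV : ∀ b, V b = expPoint (∑ e, w b e • ((P.L : ℝ)⁻¹ • logVec (su2Quat (X e))))) :
    ∑ b, ‖logVec (su2Quat (V b))‖ ^ 2 ≤ ((P.L : ℝ)⁻¹) ^ 2 * (P.L : ℝ) ^ P.d * ∑ e, ‖logVec (su2Quat (X e))‖ ^ 2 := by
  simp_rw [hV]
  exact sum_sq_norm_logVec_lift_le Finset.univ Finset.univ w (fun b _ e _ => hatW_nonneg w hw b e)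
    (fun b _ => sum_hatW_eq_one ht w hw b) (fun e _ => (sum_hatW_eq_pow ht w hw e).le) X (P.L : ℝ)⁻¹

/-- The `d = 3` reading: `Σ_b arc(V b)² ≤ L · Σ_e arc(X e)²` — the factor `√L` of §57.8 (B)'s recursion, on the nose. [cite: Balaban1985RegularSpaces, (1.29) p.81] -/
theorem sum_sq_arc_lift_le_three (hd : P.d = 3) (ht : t + 1 ≤ P.m + P.K) (w : PBond P t → PBond P (t + 1) → ℝ)
    (hw : ∀ b e, w b e = if e.dir = b.dir ∧ (b.src b.dir - emb e.src b.dir).val < P.L then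
      ∏ ν ∈ Finset.univ.erase b.dir, max 0 (1 - ((rel (emb e.src) b.src ν).natAbs : ℝ) / P.L) else 0)
    (X : GaugeField P (t + 1) SU2) (V : GaugeField P t SU2)
    (hV : ∀ b, V b = expPoint (∑ e, w b e • ((P.L : ℝ)⁻¹ • logVec (su2Quat (X e))))) :
    ∑ b, ‖logVec (su2Quat (V b))‖ ^ 2 ≤ (P.L : ℝ) * ∑ e, ‖logVec (su2Quat (X e))‖ ^ 2 := by
  have h := sum_sq_arc_lift_le ht w hw X V hV
  have hL : (P.L : ℝ) ≠ 0 := (Nat.cast_pos.mpr P.L_pos).ne'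
  rwa [hd, show ((P.L : ℝ)⁻¹) ^ 2 * (P.L : ℝ) ^ 3 = P.L by field_simp] at h

/-- **THE LIFT STAYS IN THE CHART**: `arc (V b) ≤ L⁻¹ · r` as soon as every coarse bond that feeds `b` (`w b e ≠ 0`) has `arc (X e) ≤ r`. [folklore] -/
theorem arc_lift_le (ht : t + 1 ≤ P.m + P.K) (w : PBond P t → PBond P (t + 1) → ℝ)
    (hw : ∀ b e, w b e = if e.dir = b.dir ∧ (b.src b.dir - emb e.src b.dir).val < P.L then
      ∏ ν ∈ Finset.univ.erase b.dir, max 0 (1 - ((rel (emb e.src) b.src ν).natAbs : ℝ) / P.L) else 0)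
    (X : GaugeField P (t + 1) SU2) (V : GaugeField P t SU2)
    (hV : ∀ b, V b = expPoint (∑ e, w b e • ((P.L : ℝ)⁻¹ • logVec (su2Quat (X e)))))
    (b : PBond P t) {r : ℝ} (hr : ∀ e, w b e ≠ 0 → ‖logVec (su2Quat (X e))‖ ≤ r) :
    ‖logVec (su2Quat (V b))‖ ≤ (P.L : ℝ)⁻¹ * r := by
  classical
  set S : Finset (PBond P (t + 1)) := Finset.univ.filter fun e => w b e ≠ 0 with hS
  have hsub : ∑ e ∈ S, w b e • ((P.L : ℝ)⁻¹ • logVec (su2Quat (X e))) = ∑ e, w b e • ((P.L : ℝ)⁻¹ • logVec (su2Quat (X e))) := by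
    refine Finset.sum_subset (Finset.subset_univ S) fun e _ he => ?_
    have : w b e = 0 := by simpa [hS] using he
    rw [this, zero_smul]
  have hone : ∑ e ∈ S, w b e = 1 := by
    rw [← sum_hatW_eq_one ht w hw b]
    refine Finset.sum_subset (Finset.subset_univ S) fun e _ he => ?_
    simpa [hS] using he
  rw [hV, ← hsub]
  exact norm_logVec_lift_le_of_forall_le S (fun e _ => hatW_nonneg w hw b e) hone X (inv_nonneg.mpr (Nat.cast_nonneg _))
    fun e he => hr e (by simpa [hS] using he)

/-- `log 1 = 0` in the quaternion chart. [folklore] -/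
theorem logVec_su2Quat_one : logVec (su2Quat (1 : SU2)) = 0 := by
  rw [← norm_eq_zero, norm_logVec, su2Quat_one, Real.arccos_eq_zero]
  exact le_of_eq Quaternion.re_one.symm

/-- **FLAT LIFTS TO FLAT**: `X = 1 ⟹ V = 1`. [folklore] -/
theorem lift_one (w : PBond P t → PBond P (t + 1) → ℝ) (X : GaugeField P (t + 1) SU2) (V : GaugeField P t SU2)
    (hV : ∀ b, V b = expPoint (∑ e, w b e • ((P.L : ℝ)⁻¹ • logVec (su2Quat (X e))))) (hX : X = 1) : V = 1 := by
  funext b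
  rw [hV, hX]
  have : ∀ e : PBond P (t + 1), w b e • ((P.L : ℝ)⁻¹ • logVec (su2Quat ((1 : GaugeField P (t + 1) SU2) e))) = 0 := fun e => by
    rw [show (1 : GaugeField P (t + 1) SU2) e = 1 from rfl, logVec_su2Quat_one, smul_zero, smul_zero]
  rw [Finset.sum_eq_zero fun e _ => this e, expPoint_zero]
  rfl

/-! ## §3 The bundled object -/

/-- ★★★ **THE GEODESIC WHITNEY HAT LIFT, ONE LEVEL** (UV3-NODE §57.8 (B)(D): the OBJECT `I_t(U′_{t+1})` that (R1) is about and that the relative comb-axial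
gauge of (ii-b) takes as background): for every coarse `SU(2)` field `X` on `T^{(t+1)}` (standing range `t + 1 ≤ m + K`) there are WEIGHTS `w` — the
transversal product hats centred at the block centres times the longitudinal slab indicator, EXPOSED as the first conjunct — and the fine field
`V b := expPoint (Σ_e w b e • L⁻¹ • log X e)`, with: `w ≥ 0`; partition of unity `Σ_e w b e = 1`; hat mass `Σ_b w b e = L^d`; (W1) `axialAvg V = X`;
(W2) `Σ_b arc(V b)² ≤ (L⁻¹)²·L^d·Σ_e arc(X e)²`; (W3) the chart bound; (W4) `X = 1 → V = 1`; and the locality of `w` in `rel` currency.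
[cite: Balaban1985RegularSpaces, (1.29) p.81] -/
theorem exists_whitneyHatLift (ht : t + 1 ≤ P.m + P.K) (X : GaugeField P (t + 1) SU2) :
    ∃ (w : PBond P t → PBond P (t + 1) → ℝ) (V : GaugeField P t SU2),
      (∀ b e, w b e = if e.dir = b.dir ∧ (b.src b.dir - emb e.src b.dir).val < P.L then
        ∏ ν ∈ Finset.univ.erase b.dir, max 0 (1 - ((rel (emb e.src) b.src ν).natAbs : ℝ) / P.L) else 0) ∧
      (∀ b, V b = expPoint (∑ e, w b e • ((P.L : ℝ)⁻¹ • logVec (su2Quat (X e))))) ∧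
      (∀ b e, 0 ≤ w b e) ∧ (∀ b, ∑ e, w b e = 1) ∧ (∀ e, ∑ b, w b e = (P.L : ℝ) ^ P.d) ∧
      axialAvg V = X ∧
      (∑ b, ‖logVec (su2Quat (V b))‖ ^ 2 ≤ ((P.L : ℝ)⁻¹) ^ 2 * (P.L : ℝ) ^ P.d * ∑ e, ‖logVec (su2Quat (X e))‖ ^ 2) ∧
      (∀ b (r : ℝ), (∀ e, w b e ≠ 0 → ‖logVec (su2Quat (X e))‖ ≤ r) → ‖logVec (su2Quat (V b))‖ ≤ (P.L : ℝ)⁻¹ * r) ∧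
      (X = 1 → V = 1) ∧
      (∀ b e, w b e ≠ 0 → e.dir = b.dir ∧ (0 ≤ rel (emb e.src) b.src b.dir ∧ rel (emb e.src) b.src b.dir < P.L) ∧
        ∀ ν, ν ≠ b.dir → (rel (emb e.src) b.src ν).natAbs < P.L) := by
  refine ⟨fun b e => if e.dir = b.dir ∧ (b.src b.dir - emb e.src b.dir).val < P.L then
      ∏ ν ∈ Finset.univ.erase b.dir, max 0 (1 - ((rel (emb e.src) b.src ν).natAbs : ℝ) / P.L) else 0,
    fun b => expPoint (∑ e, (if e.dir = b.dir ∧ (b.src b.dir - emb e.src b.dir).val < P.L then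
      ∏ ν ∈ Finset.univ.erase b.dir, max 0 (1 - ((rel (emb e.src) b.src ν).natAbs : ℝ) / P.L) else 0) •
        ((P.L : ℝ)⁻¹ • logVec (su2Quat (X e)))),
    fun _ _ => rfl, fun _ => rfl, ?_, ?_, ?_, ?_, ?_, ?_, ?_, ?_⟩
  · exact hatW_nonneg _ (fun _ _ => rfl)
  · exact sum_hatW_eq_one ht _ (fun _ _ => rfl)
  · exact sum_hatW_eq_pow ht _ (fun _ _ => rfl)
  · exact axialAvg_lift ht _ (fun _ _ => rfl) X _ (fun _ => rfl)
  · exact sum_sq_arc_lift_le ht _ (fun _ _ => rfl) X _ (fun _ => rfl)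
  · exact fun b r hr => arc_lift_le ht _ (fun _ _ => rfl) X _ (fun _ => rfl) b hr
  · exact lift_one _ X _ (fun _ => rfl)
  · exact fun b e hbe => hatW_support ht _ (fun _ _ => rfl) hbe

end Summit.QuantumFields.YangMills.Theorems.FluctuationComparisonRegPrIntLS2BetaWhitneyHatLift

end
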